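import Literature.NumberTheory.LFunctions.DeuringPhenomenonElementaryTheoremTwoProofs
import Literature.NumberTheory.QuadraticFields.KroneckerCharacterEvenDiscriminant
import Literature.NumberTheory.QuadraticFields.QuadraticDedekindZeta
import Literature.NumberTheory.QuadraticFields.JacobiCharacterPrimitiveProofs
import Mathlib.Analysis.SpecialFunctions.Pow.Asymptotics
import HarnessLib

/-!
# The weakened Mordell theorem by Pintz's elementary method (Pintz 1976 III, p. 295; Bellotti–Puglisi
# 2023, p. 2): a zero of `ζ` in `σ > 3/4` forces `h(−D) > (log D)^{3/4}` for `D > D₀` — PROVED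

Topic `Literature/NumberTheory/LFunctions` (namespace `Literature.NumberTheory.LFunctions`, grouping
sub-namespace `Pintz1976Deuring`). PROOF LAYER companion of `DeuringPhenomenonElementary.lean` (cell
`parity-realchar`, SIEGEL INSTRUMENT, conditionals column I.1 «class numbers», the DEURING direction
«RH false ⟹ `h(−D) → ∞` effectively», cf. the named fact `bellottiPuglisi2023_corollary1` of
`ElementaryDeuringHeilbronnPhenomenon.lean`, which is the deeper `σ > 1/2` version).

PRINT. Pintz 1976 III, p. 295 (after Theorem 2, whose (1.8) says that under `h(−D) ≤ (log D)^{3/4}`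
"neither `L(s)` nor `ζ(s)` has a zero in `H(ε, D)`"): "Also, a weakened form of Mordell's theorem
follows, namely that if `h(−D) ↛ ∞` for `D → ∞`, then `ζ(s)` has no zero in the half-plane `σ > ¾`."
Bellotti–Puglisi 2023, p. 2, the same sentence. HERE (everything PROVED, from the tree's discharged
`pintz1976Deuring_theorem2_holds`):

* `Pintz1976Deuring.exists_odd_quadratic_primitive_char` — the Kronecker character of an imaginary
  quadratic field is an odd primitive quadratic character mod `|d_K|` (the datum Theorem 2 asks for;
  tree: Jacobi character for odd `d_K`, `Quadratic.exists_kroneckerChar_of_four_dvd` for even `d_K`).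
* `Pintz1976Deuring.classNumber_gt_of_riemannZeta_eq_zero` — QUANTITATIVE FORM: if `ζ(β + iγ) = 0`
  with `β > 3/4` then there is `D₀ = D₀(β, γ)` with `h_K > (log|d_K|)^{3/4}` for every imaginary
  quadratic field `K` with `|d_K| > D₀` (Theorem 2 with `ε = (β − ¾)/2`: for large `D` the point
  `β + iγ` lies in `H(ε, D)`, where `ζ` would be zero-free if `h_K ≤ (log|d_K|)^{3/4}`).
* `Pintz1976Deuring.riemannZeta_ne_zero_of_classNumber_bounded_io` — THE PRINTED FORM: if `h(−D)`
  stays bounded along imaginary quadratic fields of arbitrarily large discriminant, then `ζ(s) ≠ 0`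
  for `Re s > 3/4`.

LABEL (cell rule): instrument / proof layer. WHAT THIS IS NOT: no claim that `ζ` has a zero off the
critical line, nor that class numbers stay small (they do not: Heilbronn); the threshold `D₀` is
effective in principle but not evaluated. No instances, no notation, no axioms beyond the standard three.

## References

* [Pintz1976ElementaryIII] J. Pintz, *Elementary methods in the theory of L-functions, III. The
  Deuring-phenomenon*, Acta Arith. 31 (1976) 295–306: Theorem 2 pp. 296–297 (1.7)–(1.9) and the remark
  p. 295 (weakened Mordell theorem).
* [BellottiPuglisi2023] C. Bellotti, G. Puglisi, Acta Arith. 208 (2023) 257–277 = arXiv:2201.03990v3,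
  p. 2 (the same remark) and Corollary 1 p. 4 (the `σ > 1/2` refinement, a named fact in the tree).
* L. J. Mordell, J. London Math. Soc. 9 (1934) 289–298 (the original theorem; cited as [17] in
  Bellotti–Puglisi and as Mordell's theorem by Pintz).
-/

noncomputable section

open Complex Filter Topology

namespace Literature.NumberTheory.LFunctions

namespace Pintz1976Deuring

open Literature.NumberTheory.QuadraticFields Literature.NumberTheory.QuadraticFields.Quadratic

/-- **The Kronecker character of an imaginary quadratic field** is an odd primitive quadratic
character `κ ≠ χ₀` mod `|d_K|`: for odd `d_K ≡ 1 (mod 4)`, `d_K < 0`, the Jacobi character mod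
`|d_K| ≡ 3 (mod 4)` (`(−1/|d_K|) = −1`); for even `d_K` the tree's Kronecker character mod `4|m|`.
[cite: MontgomeryVaughan2007, §9.3 Theorem 9.13] -/
theorem exists_odd_quadratic_primitive_char {K : Type*} [Field K] [NumberField K]
    (h2 : Module.finrank ℚ K = 2) (hd : NumberField.discr K < 0) :
    ∃ κ : DirichletCharacter ℂ (NumberField.discr K).natAbs,
      κ.IsQuadratic ∧ κ.IsPrimitive ∧ κ.Odd := by
  haveI := neZero_natAbs_discr (K := K)
  rcases isFundamentalDiscriminant_discr (K := K) h2 with ⟨h1, hsqf, -⟩ | ⟨h4, -, -⟩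
  · have hodd : Odd (NumberField.discr K) := by rw [Int.odd_iff]; omega
    have hoddN : Odd (NumberField.discr K).natAbs := Int.natAbs_odd.mpr hodd
    have hsqN : Squarefree (NumberField.discr K).natAbs := Int.squarefree_natAbs.mpr hsqf
    have hmod : (NumberField.discr K).natAbs % 4 = 3 := by
      have : ((NumberField.discr K).natAbs : ℤ) = -NumberField.discr K :=
        Int.ofNat_natAbs_of_nonpos hd.le
      omega
    have hoddκ : (Literature.NumberTheory.QuadraticFields.jacobiChar (NumberField.discr K).natAbs).Odd := by
      show Literature.NumberTheory.QuadraticFields.jacobiChar (NumberField.discr K).natAbs (-1) = -1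
      have h := Literature.NumberTheory.QuadraticFields.jacobiChar_intCast
        (q := (NumberField.discr K).natAbs) (-1)
      rw [Int.cast_neg, Int.cast_one] at h
      rw [h, jacobiSym.at_neg_one hoddN, ZMod.χ₄_nat_three_mod_four hmod, Int.cast_neg, Int.cast_one]
    exact ⟨Literature.NumberTheory.QuadraticFields.jacobiChar (NumberField.discr K).natAbs,
      fun a => Literature.NumberTheory.QuadraticFields.jacobiChar_trichotomy a,
      Literature.NumberTheory.QuadraticFields.isPrimitive_jacobiChar hoddN hsqN, hoddκ⟩
  · obtain ⟨κ, hprim, hquad, -, -, -, hod, -⟩ := exists_kroneckerChar_of_four_dvd h2 h4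
    exact ⟨κ, hquad, hprim, hod hd⟩

/-- The thresholds for the region membership, valid for all large `D`:
`D₁ < D`, `1/τ ≤ log⁴D`, `D^{−ε/4} ≤ τ`, `R ≤ D^e` (`τ, ε, e > 0`). [folklore] -/
private theorem eventually_region_thresholds {τ ε e R : ℝ} (hτ : 0 < τ) (hε : 0 < ε) (he : 0 < e)
    (D₁ : ℕ) :
    ∃ D₀ : ℕ, ∀ D : ℕ, D₀ < D →
      D₁ < D ∧ 1 / τ ≤ Real.log D ^ 4 ∧ (D : ℝ) ^ (-ε / 4) ≤ τ ∧ R ≤ (D : ℝ) ^ e := by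
  have h1 : ∀ᶠ x : ℝ in atTop, (D₁ : ℝ) < x := Filter.eventually_gt_atTop _
  have h2 : ∀ᶠ x : ℝ in atTop, 1 / τ ≤ Real.log x ^ 4 := by
    have ht : Tendsto (fun x : ℝ => Real.log x ^ 4) atTop atTop :=
      (tendsto_pow_atTop (by norm_num : (4 : ℕ) ≠ 0)).comp Real.tendsto_log_atTop
    exact ht.eventually_ge_atTop _
  have h3 : ∀ᶠ x : ℝ in atTop, x ^ (-ε / 4) ≤ τ := by
    have ht : Tendsto (fun x : ℝ => x ^ (-ε / 4)) atTop (𝓝 0) :=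
      tendsto_rpow_neg_atTop (by linarith : 0 < ε / 4) |>.congr fun x => by ring_nf
    exact (ht.eventually (Iic_mem_nhds hτ)).mono fun x hx => hx
  have h4 : ∀ᶠ x : ℝ in atTop, R ≤ x ^ e := (tendsto_rpow_atTop he).eventually_ge_atTop R
  obtain ⟨N, hN⟩ := Filter.eventually_atTop.mp
    (tendsto_natCast_atTop_atTop.eventually (h1.and (h2.and (h3.and h4))))
  refine ⟨N, fun D hD => ?_⟩
  obtain ⟨a, b, c, d⟩ := hN D hD.le
  exact ⟨by exact_mod_cast a, b, c, d⟩

/-- **The weakened Mordell theorem, quantitative form (PROVED).** If `ζ(β + iγ) = 0` with `β > 3/4`,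
then there is `D₀ = D₀(β, γ)` such that every imaginary quadratic field `K` with `|d_K| > D₀` has
`h_K > (log|d_K|)^{3/4}`. From Pintz's Theorem 2 (tree: `pintz1976Deuring_theorem2_holds`) with
`ε = (β − ¾)/2`: for `D` large the zero lies in `H(ε, D)`, which is `ζ`-free as soon as
`h_K ≤ (log|d_K|)^{3/4}`. [cite: Pintz1976ElementaryIII, Theorem 2 (1.8) and p. 295 (weakened Mordell)]
[cite: BellottiPuglisi2023, p. 2] -/
theorem classNumber_gt_of_riemannZeta_eq_zero :
    ∀ β γ : ℝ, 3 / 4 < β → riemannZeta (β + γ * Complex.I) = 0 →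
      ∃ D₀ : ℕ, ∀ (K : Type) [Field K] [NumberField K], Module.finrank ℚ K = 2 →
        NumberField.discr K < 0 → D₀ < (NumberField.discr K).natAbs →
          Real.log (NumberField.discr K).natAbs ^ (3 / 4 : ℝ) < (NumberField.classNumber K : ℝ) := by
  intro β γ hβ hz
  set s : ℂ := β + γ * Complex.I with hsdef
  have hsre : s.re = β := by simp [hsdef]
  -- `β < 1` (no zeros on `Re s ≥ 1`)
  have hβ1 : β < 1 := by
    by_contra hle
    push Not at hle
    exact riemannZeta_ne_zero_of_one_le_re (s := s) (by rw [hsre]; exact hle) hz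
  -- parameters
  set τ : ℝ := 1 - β with hτdef
  have hτ0 : 0 < τ := by simp only [hτdef]; linarith
  set ε : ℝ := (β - 3 / 4) / 2 with hεdef
  have hε0 : 0 < ε := by simp only [hεdef]; linarith
  have hε8 : ε < 1 / 8 := by simp only [hεdef]; linarith
  have hτε : τ ≤ 1 / 4 - ε := by simp only [hτdef, hεdef]; linarith
  set e : ℝ := (1 / 4 - ε / 2) / τ - 3 / 4 with hedef
  have he0 : 0 < e := by
    simp only [hedef]
    rw [sub_pos, lt_div_iff₀ hτ0]
    nlinarith
  obtain ⟨D₁, hD₁⟩ := riemannZeta_ne_zero_of_theorem2 pintz1976Deuring_theorem2_holds hε0 hε8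
  obtain ⟨D₀, hD₀⟩ := eventually_region_thresholds (R := ‖s‖) hτ0 hε0 he0 D₁
  refine ⟨D₀, fun K _ _ h2 hneg hD => ?_⟩
  haveI := neZero_natAbs_discr (K := K)
  set D : ℕ := (NumberField.discr K).natAbs with hDdef
  obtain ⟨hD₁D, hlog, hpow, hsize⟩ := hD₀ D hD
  by_contra hle
  push Not at hle
  have hκ := exists_odd_quadratic_primitive_char h2 hneg
  -- `s ∈ H(ε, D)`
  have hD0 : (0 : ℝ) < D := by exact_mod_cast (show 0 < D by omega)
  have hmem : s ∈ Pintz1976Deuring.region ε D := by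
    refine ⟨?_, ?_, ?_, ?_⟩
    · -- `1/log⁴D ≤ ‖1 − s‖`
      have h1 : τ ≤ ‖1 - s‖ := by
        have := Complex.abs_re_le_norm (1 - s)
        rw [sub_re, one_re, hsre] at this
        have hτ' : |1 - β| = τ := abs_of_pos hτ0
        linarith [hτ'.symm.le, this]
      have hlog0 : 0 < Real.log D ^ 4 := lt_of_lt_of_le (by positivity) hlog
      calc 1 / Real.log D ^ 4 ≤ τ := by
            rw [div_le_iff₀ hlog0]
            have := (div_le_iff₀ hτ0).mp hlog
            linarith
        _ ≤ ‖1 - s‖ := h1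
    · rw [hsre]; linarith
    · rw [hsre]; exact hτε
    · have hmax : max (1 - s.re) ((D : ℝ) ^ (-ε / 4)) = τ := by
        rw [hsre]; exact max_eq_left hpow
      rw [hmax]
      exact hsize
  exact hD₁ K h2 hneg hD₁D hle hκ s hmem hz

/-- **The weakened Mordell theorem, as printed (PROVED):** "if `h(−D) ↛ ∞` for `D → ∞`, then `ζ(s)`
has no zero in the half-plane `σ > ¾`" — if some bound `h₀` is attained by the class numbers of
imaginary quadratic fields of arbitrarily large discriminant, then `ζ(s) ≠ 0` for `Re s > 3/4`.
[cite: Pintz1976ElementaryIII, p. 295 (weakened Mordell theorem)] [cite: BellottiPuglisi2023, p. 2] -/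
theorem riemannZeta_ne_zero_of_classNumber_bounded_io {h₀ : ℝ}
    (hsmall : ∀ q₀ : ℕ, ∃ (K : Type) (_ : Field K) (_ : NumberField K),
      Module.finrank ℚ K = 2 ∧ NumberField.discr K < 0 ∧ q₀ < (NumberField.discr K).natAbs ∧
        (NumberField.classNumber K : ℝ) ≤ h₀)
    {s : ℂ} (hs : 3 / 4 < s.re) : riemannZeta s ≠ 0 := by
  intro hz
  have hs' : riemannZeta (s.re + s.im * Complex.I) = 0 := by
    rw [Complex.re_add_im s]; exact hz
  obtain ⟨D₀, hD₀⟩ := classNumber_gt_of_riemannZeta_eq_zero s.re s.im hs hs'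
  -- beyond `D₀` and beyond the point where `(log D)^{3/4} ≥ h₀`
  have hev : ∀ᶠ x : ℝ in atTop, h₀ ≤ Real.log x ^ (3 / 4 : ℝ) :=
    ((tendsto_rpow_atTop (by norm_num : (0 : ℝ) < 3 / 4)).comp Real.tendsto_log_atTop).eventually_ge_atTop h₀
  obtain ⟨N, hN⟩ := Filter.eventually_atTop.mp (tendsto_natCast_atTop_atTop.eventually hev)
  obtain ⟨K, _, _, h2, hneg, hq, hle⟩ := hsmall (max D₀ N)
  have h1 := hD₀ K h2 hneg (lt_of_le_of_lt (le_max_left _ _) hq)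
  have h2' : h₀ ≤ Real.log (NumberField.discr K).natAbs ^ (3 / 4 : ℝ) :=
    hN _ ((le_max_right _ _).trans hq.le)
  linarith

end Pintz1976Deuring

end Literature.NumberTheory.LFunctions

end
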